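import Summits.HubbardSuperconductivity.HubbardSuperconductivity.Theses.ThermalWedge
import Summits.HubbardSuperconductivity.HubbardSuperconductivity.Theorems.TwTipContinuation.Negative.SeededChords
import Literature.MathematicalPhysics.QuantumLattice.LatticeToriLROProofs

/-!
# `TwTipContinuation` (stmt-HubbardSuperconductivity-1700) — NORMAL FORM of the crux and corner tools (negative-side support)

Route `ThermalWedge`, crux rank 6 ("the bet"). Extracted, definition-free, from the standing
disprover's work file `Cruxes/TwTipContinuation/Disproof.lean` (gen 2) so that the statements sit in
`Theorems/` on the LITERAL route terms:

* `everyGSOrder_mono` — the every-ground-state order bound of the seeded family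
  `hubbardTorus 2 L 1 U − (g/L²)(pairField d L)ᴴ(pairField d L)` is an UP-SET in the seed `g`;
* `summitMatrix_iff_everyGSOrder` (`δ ≥ −1`) — the summit's conclusion at `(U,δ)` (every admissible
  ground-state sequence of the PURE torus has d-wave `HasLongRangeOrder` along even sides) is
  EQUIVALENT to an eventual, uniform, every-ground-state bound `c L⁴ ≤ re⟨ψ,(Δᴴ Δ)ψ⟩` (hard half
  without compactness: a `Nat.findGreatest` diagonal of near-worst ground states);
* `twTipContinuation_iff_threshold` — **the crux in normal form**:
  `TwTipContinuation ⟺ ∃U₁>0 ∃δ∈[1/10,2/5] ∀U∈(0,U₁], (every-GS order at seed 1/20) → (every-GS order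
  of the pure torus)`. The universally quantified slope `K` (typed after `U` under `K·U ≤ 1/20`)
  collapses to `K = 1/(20U)`, and by monotonicity the whole seed band `[K·U, 1/10]` to the single
  seed `1/20`: nothing "comparable with the bare `U`" is ever consumed;
* `not_twTipContinuation_iff` — what a refutation needs (lit at `1/20` AND dark at `0`, at EVERY `δ`
  of the window, for arbitrarily small `U`); `twTipContinuation_of_anchorFailure` (vacuity hazard:
  failure of the O(1)-seeded anchor at one `δ` proves the crux), `twTipContinuation_of_uniformSummit`
  (intended reading), `not_summitMatrix_of_darkSeed` (dark at any seed `g ≥ 0` refutes the summit at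
  `(U,δ)` — every rung of the anchor is necessary there);
(Corner tools on sector energies live in the companion file `Negative/TipCornerTools.lean`.)

All folklore bookkeeping over the finite-dimensional variational principle (Tasaki 2020 §2.1–2.2) and
Friedli–Velenik 2017 §3.7.2 (LRO as a liminf); no new definitions.
-/

noncomputable section

namespace Summit.HubbardSuperconductivity.TwTipContinuation.Negative

open Matrix Filter Finset
open Literature.MathematicalPhysics.QuantumLattice Literature.Probability.LatticeModels
open Summit.HubbardSuperconductivity.HubbardSuperconductivity.Theses.ThermalWedge
open scoped ComplexOrder

/-! ### Monotonicity of the every-GS order bound in the seed -/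

/-- **The every-GS order bound is an up-set in the seed** (`g₁ ≤ g₂`; same constant, same `L₀`). [folklore] -/
theorem everyGSOrder_mono {U δ g₁ g₂ : ℝ} (hg : g₁ ≤ g₂)
    (h : (∃ c : ℝ, 0 < c ∧ ∃ L₀ : ℕ, ∀ (L : ℕ) [NeZero L], L₀ ≤ L → Even L →
        ∀ ψ : Fock (Orb (FermionTorus 2 L)), star ψ ⬝ᵥ ψ = 1 →
          IsGroundStateInSector (hubbardTorus 2 L 1 U - ((g₁ / (L : ℝ) ^ 2 : ℝ) : ℂ) • ((pairField dWaveFormFactor L)ᴴ * pairField dWaveFormFactor L)) (2 * ⌊(1 - δ) * (L : ℝ) ^ 2 / 2⌋₊) 0 ψ →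
            c * (L : ℝ) ^ 4 ≤ (expect ((pairField dWaveFormFactor L)ᴴ * pairField dWaveFormFactor L) ψ).re)) :
    (∃ c : ℝ, 0 < c ∧ ∃ L₀ : ℕ, ∀ (L : ℕ) [NeZero L], L₀ ≤ L → Even L →
        ∀ ψ : Fock (Orb (FermionTorus 2 L)), star ψ ⬝ᵥ ψ = 1 →
          IsGroundStateInSector (hubbardTorus 2 L 1 U - ((g₂ / (L : ℝ) ^ 2 : ℝ) : ℂ) • ((pairField dWaveFormFactor L)ᴴ * pairField dWaveFormFactor L)) (2 * ⌊(1 - δ) * (L : ℝ) ^ 2 / 2⌋₊) 0 ψ →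
            c * (L : ℝ) ^ 4 ≤ (expect ((pairField dWaveFormFactor L)ᴴ * pairField dWaveFormFactor L) ψ).re) := by
  rcases eq_or_lt_of_le hg with rfl | hlt
  · exact h
  obtain ⟨c, hc, L₀, hL⟩ := h
  refine ⟨c, hc, L₀, fun L _ hL₀ hE ψ hψ hgs => ?_⟩
  have hn := le_card_of_mem_szSector L hgs.1 hgs.2.1
  obtain ⟨ψ₁, hψ₁, hgs₁⟩ := exists_unit_groundState U g₁ L hn
  exact (hL L hL₀ hE ψ₁ hψ₁ hgs₁).trans (expect_pairIntensity_mono hlt hψ₁ hψ hgs₁ hgs)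

/-! ### The LRO sequence of the summit's conclusion at nonzero even sides -/

/-- `Σ_{x,y} G_L(x,y) = re ⟨ψ_L, Δᴴ Δ ψ_L⟩` at every nonzero side. [folklore] -/
theorem sum_pairFieldCorr (g : Site 2 → ℝ) (ψ : ∀ L, Fock (Orb (FermionTorus 2 L))) (L : ℕ)
    [NeZero L] :
    ∑ x : TorusSite 2 L, ∑ y, pairFieldCorr g ψ L x y =
      (expect ((pairField g L)ᴴ * pairField g L) (ψ L)).re := by
  obtain ⟨L', rfl⟩ := Nat.exists_eq_add_one_of_ne_zero (NeZero.ne L)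
  exact sum_pairFieldCorr_succ g ψ L'

/-- The normalised pull-back double sum at a nonzero side is the normalised torus double sum. [folklore] -/
theorem sum_torusPullback_two (G : (L : ℕ) → TorusSite 2 L → TorusSite 2 L → ℝ) (L : ℕ) [NeZero L] :
    (∑ x ∈ halfOpenBox 2 L, ∑ y ∈ halfOpenBox 2 L, torusPullback G L x y) /
        ((halfOpenBox 2 L).card : ℝ) ^ 2 =
      (∑ x : TorusSite 2 L, ∑ y : TorusSite 2 L, G L x y) / (L : ℝ) ^ 4 := by
  obtain ⟨L', rfl⟩ := Nat.exists_eq_add_one_of_ne_zero (NeZero.ne L)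
  rw [sum_torusPullback_succ (d := 2) G L']

/-- At a nonzero even side the LRO-sequence term is `re ⟨ψ_{2k}, (ΔᴴΔ) ψ_{2k}⟩ / (2k)⁴`. [folklore] -/
theorem lroTerm_eq (ψ : ∀ L, Fock (Orb (FermionTorus 2 L))) (k : ℕ) [NeZero (2 * k)] :
    (∑ x ∈ halfOpenBox 2 (2 * k), ∑ y ∈ halfOpenBox 2 (2 * k),
          torusPullback (pairFieldCorr dWaveFormFactor ψ) (2 * k) x y) /
        ((halfOpenBox 2 (2 * k)).card : ℝ) ^ 2 =
      (expect ((pairField dWaveFormFactor (2 * k))ᴴ * pairField dWaveFormFactor (2 * k)) (ψ (2 * k))).re / ((2 * k : ℕ) : ℝ) ^ 4 := by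
  rw [sum_torusPullback_two, sum_pairFieldCorr]

/-- `0 < (2k)⁴` as a real number once `2k ≠ 0`. [folklore] -/
theorem side_pow_pos (k : ℕ) [NeZero (2 * k)] : (0 : ℝ) < ((2 * k : ℕ) : ℝ) ^ 4 :=
  pow_pos (Nat.cast_pos.2 (Nat.pos_of_ne_zero (NeZero.ne (2 * k)))) 4

/-- `re ⟨ψ, (ΔᴴΔ) ψ⟩ ≤ C_d² L⁴` for unit `ψ`, `C_d² = (Σ_{e ∈ {0} ∪ unitSteps} 2|d(e)|/√2)²`. [folklore] -/
theorem expect_pairIntensity_le (L : ℕ) [NeZero L] (ψ : Fock (Orb (FermionTorus 2 L)))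
    (hψ : star ψ ⬝ᵥ ψ = 1) :
    (expect ((pairField dWaveFormFactor L)ᴴ * pairField dWaveFormFactor L) ψ).re ≤
      (∑ e ∈ insert 0 unitSteps, ‖((dWaveFormFactor e / Real.sqrt 2 : ℝ) : ℂ)‖ * 2) ^ 2 * (L : ℝ) ^ 4 := by
  classical
  obtain ⟨L', rfl⟩ := Nat.exists_eq_add_one_of_ne_zero (NeZero.ne L)
  set fam : ∀ L, Fock (Orb (FermionTorus 2 L)) := Function.update (fun _ => 0) (L' + 1) ψ with hfam
  have hfamL : fam (L' + 1) = ψ := by simp [hfam]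
  have hnorm : star (fam (L' + 1)) ⬝ᵥ fam (L' + 1) = 1 := by rw [hfamL, hψ]
  have hsum := sum_pairFieldCorr_succ dWaveFormFactor fam L'
  rw [hfamL] at hsum
  rw [← hsum]
  calc ∑ x : TorusSite 2 (L' + 1), ∑ y, pairFieldCorr dWaveFormFactor fam (L' + 1) x y
      ≤ ∑ _x : TorusSite 2 (L' + 1), ∑ _y : TorusSite 2 (L' + 1),
          (∑ e ∈ insert 0 unitSteps, ‖((dWaveFormFactor e / Real.sqrt 2 : ℝ) : ℂ)‖ * 2) ^ 2 :=
        Finset.sum_le_sum fun x _ => Finset.sum_le_sum fun y _ =>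
          pairFieldCorr_succ_le dWaveFormFactor fam L' hnorm x y
    _ = (∑ e ∈ insert 0 unitSteps, ‖((dWaveFormFactor e / Real.sqrt 2 : ℝ) : ℂ)‖ * 2) ^ 2 * ((L' + 1 : ℕ) : ℝ) ^ 4 := by
        simp only [Finset.sum_const, Finset.card_univ, Fintype.card_pi, ZMod.card,
          Finset.prod_const, Fintype.card_fin, nsmul_eq_mul]
        push_cast
        ring

/-- The LRO-sequence term is nonnegative at every `k`. [folklore] -/
theorem lroTerm_nonneg (ψ : ∀ L, Fock (Orb (FermionTorus 2 L))) (k : ℕ) :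
    0 ≤ (∑ x ∈ halfOpenBox 2 (2 * k), ∑ y ∈ halfOpenBox 2 (2 * k),
          torusPullback (pairFieldCorr dWaveFormFactor ψ) (2 * k) x y) /
        ((halfOpenBox 2 (2 * k)).card : ℝ) ^ 2 := by
  rcases Nat.eq_zero_or_pos k with rfl | hk
  · simp [card_halfOpenBox]
  · haveI : NeZero (2 * k) := ⟨by omega⟩
    rw [lroTerm_eq]
    exact div_nonneg (expect_pairIntensity_nonneg _ _) (side_pow_pos k).le

/-! ### The summit's matrix at `(U,δ)` is the every-GS order bound of the pure torus -/

/-- **(easy half)** an eventual uniform every-GS bound gives the summit's conclusion at `(U,δ)`. [folklore] -/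
theorem summitMatrix_of_everyGSOrder {U δ : ℝ}
    (h : (∃ c : ℝ, 0 < c ∧ ∃ L₀ : ℕ, ∀ (L : ℕ) [NeZero L], L₀ ≤ L → Even L →
        ∀ ψ : Fock (Orb (FermionTorus 2 L)), star ψ ⬝ᵥ ψ = 1 →
          IsGroundStateInSector (hubbardTorus 2 L 1 U) (2 * ⌊(1 - δ) * (L : ℝ) ^ 2 / 2⌋₊) 0 ψ →
            c * (L : ℝ) ^ 4 ≤ (expect ((pairField dWaveFormFactor L)ᴴ * pairField dWaveFormFactor L) ψ).re)) :
    (∀ (N : ℕ → ℕ) (ψ : ∀ L, Fock (Orb (FermionTorus 2 L))),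
        (∀ L, Even L → N L = 2 * ⌊(1 - δ) * (L : ℝ) ^ 2 / 2⌋₊ ∧ star (ψ L) ⬝ᵥ ψ L = 1 ∧
            IsGroundStateInSector (hubbardTorus 2 L 1 U) (N L) 0 (ψ L)) →
          HasLongRangeOrder (fun k => halfOpenBox 2 (2 * k))
            (fun k => torusPullback (pairFieldCorr dWaveFormFactor ψ) (2 * k))) := by
  obtain ⟨c, hc, L₀, hL⟩ := h
  intro N ψ hyp
  change 0 < liminf (fun k : ℕ => (∑ x ∈ halfOpenBox 2 (2 * k), ∑ y ∈ halfOpenBox 2 (2 * k),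
          torusPullback (pairFieldCorr dWaveFormFactor ψ) (2 * k) x y) /
        ((halfOpenBox 2 (2 * k)).card : ℝ) ^ 2) atTop
  have hev : ∀ᶠ k in atTop, c ≤ (∑ x ∈ halfOpenBox 2 (2 * k), ∑ y ∈ halfOpenBox 2 (2 * k),
          torusPullback (pairFieldCorr dWaveFormFactor ψ) (2 * k) x y) /
        ((halfOpenBox 2 (2 * k)).card : ℝ) ^ 2 := by
    refine eventually_atTop.2 ⟨L₀ + 1, fun k hk => ?_⟩
    haveI : NeZero (2 * k) := ⟨by omega⟩
    obtain ⟨hN, hu, hgs⟩ := hyp (2 * k) (even_two_mul k)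
    rw [hN] at hgs
    have hb := hL (2 * k) (by omega) (even_two_mul k) (ψ (2 * k)) hu hgs
    rw [lroTerm_eq, le_div_iff₀ (side_pow_pos k)]
    exact hb
  have hev' : ∀ᶠ k in atTop, (∑ x ∈ halfOpenBox 2 (2 * k), ∑ y ∈ halfOpenBox 2 (2 * k),
          torusPullback (pairFieldCorr dWaveFormFactor ψ) (2 * k) x y) /
        ((halfOpenBox 2 (2 * k)).card : ℝ) ^ 2 ≤
      (∑ e ∈ insert 0 unitSteps, ‖((dWaveFormFactor e / Real.sqrt 2 : ℝ) : ℂ)‖ * 2) ^ 2 := by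
    refine eventually_atTop.2 ⟨1, fun k hk => ?_⟩
    haveI : NeZero (2 * k) := ⟨by omega⟩
    obtain ⟨-, hu, -⟩ := hyp (2 * k) (even_two_mul k)
    rw [lroTerm_eq, div_le_iff₀ (side_pow_pos k)]
    exact expect_pairIntensity_le (2 * k) (ψ (2 * k)) hu
  exact lt_of_lt_of_le hc (le_liminf_of_le (isCoboundedUnder_ge_of_eventually_le _ hev') hev)

/-- **(hard half, no compactness)** the summit's conclusion at `(U,δ)` forces a uniform every-GS
order bound for the pure torus: otherwise a diagonal choice of near-worst ground states
(`Nat.findGreatest` over badness levels `re⟨ΔᴴΔ⟩ < L⁴/(n+1)`) is an admissible sequence whose LRO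
`liminf` is `≤ 0`. [folklore] -/
theorem everyGSOrder_of_summitMatrix {U δ : ℝ} (hδ : -1 ≤ δ)
    (hS : (∀ (N : ℕ → ℕ) (ψ : ∀ L, Fock (Orb (FermionTorus 2 L))),
        (∀ L, Even L → N L = 2 * ⌊(1 - δ) * (L : ℝ) ^ 2 / 2⌋₊ ∧ star (ψ L) ⬝ᵥ ψ L = 1 ∧
            IsGroundStateInSector (hubbardTorus 2 L 1 U) (N L) 0 (ψ L)) →
          HasLongRangeOrder (fun k => halfOpenBox 2 (2 * k))
            (fun k => torusPullback (pairFieldCorr dWaveFormFactor ψ) (2 * k)))) :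
    (∃ c : ℝ, 0 < c ∧ ∃ L₀ : ℕ, ∀ (L : ℕ) [NeZero L], L₀ ≤ L → Even L →
        ∀ ψ : Fock (Orb (FermionTorus 2 L)), star ψ ⬝ᵥ ψ = 1 →
          IsGroundStateInSector (hubbardTorus 2 L 1 U) (2 * ⌊(1 - δ) * (L : ℝ) ^ 2 / 2⌋₊) 0 ψ →
            c * (L : ℝ) ^ 4 ≤ (expect ((pairField dWaveFormFactor L)ᴴ * pairField dWaveFormFactor L) ψ).re) := by
  classical
  by_contra hOB
  -- badness at level `n`, side `L`
  let bad : ℕ → ℕ → Prop := fun n L => ∃ _ : NeZero L, ∃ ψ : Fock (Orb (FermionTorus 2 L)),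
    star ψ ⬝ᵥ ψ = 1 ∧ IsGroundStateInSector (hubbardTorus 2 L 1 U) (2 * ⌊(1 - δ) * (L : ℝ) ^ 2 / 2⌋₊) 0 ψ ∧
      (expect ((pairField dWaveFormFactor L)ᴴ * pairField dWaveFormFactor L) ψ).re < 1 / ((n : ℝ) + 1) * (L : ℝ) ^ 4
  have key : ∀ n L₀ : ℕ, ∃ L, L₀ ≤ L ∧ Even L ∧ bad n L := by
    intro n L₀
    by_contra hno
    apply hOB
    refine ⟨1 / ((n : ℝ) + 1), by positivity, L₀, fun L _ hL₀ hE ψ hψ hgs => ?_⟩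
    by_contra hlt
    exact hno ⟨L, hL₀, hE, ‹NeZero L›, ψ, hψ, hgs, not_le.mp hlt⟩
  let lvl : ℕ → ℕ := fun L => Nat.findGreatest (fun n => bad n L) L
  have hspec : ∀ L n, n ≤ L → bad n L → bad (lvl L) L :=
    fun L n hn hb => Nat.findGreatest_spec (P := fun m => bad m L) hn hb
  have hge : ∀ L n, n ≤ L → bad n L → n ≤ lvl L :=
    fun L n hn hb => Nat.le_findGreatest (P := fun m => bad m L) hn hb
  have hex : ∀ L, ∃ ψ : Fock (Orb (FermionTorus 2 L)), star ψ ⬝ᵥ ψ = 1 ∧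
      IsGroundStateInSector (hubbardTorus 2 L 1 U) (2 * ⌊(1 - δ) * (L : ℝ) ^ 2 / 2⌋₊) 0 ψ ∧
      (bad (lvl L) L → ∃ _ : NeZero L,
        (expect ((pairField dWaveFormFactor L)ᴴ * pairField dWaveFormFactor L) ψ).re <
          1 / ((lvl L : ℝ) + 1) * (L : ℝ) ^ 4) := by
    intro L
    by_cases hb : bad (lvl L) L
    · obtain ⟨inst, ψ, h1, h2, h3⟩ := hb
      exact ⟨ψ, h1, h2, fun _ => ⟨inst, h3⟩⟩
    · obtain ⟨ψ, h1, h2⟩ :=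
        Summit.HubbardSuperconductivity.NoGo.exists_unit_groundStateInSector_hubbardTorus L 1 U
          (Summit.HubbardSuperconductivity.NoGo.floor_pairNumber_le δ hδ L)
      exact ⟨ψ, h1, h2, fun h => absurd h hb⟩
  choose ψ hψu hψgs hψbad using hex
  have hLRO : 0 < liminf (fun k : ℕ => (∑ x ∈ halfOpenBox 2 (2 * k), ∑ y ∈ halfOpenBox 2 (2 * k),
          torusPullback (pairFieldCorr dWaveFormFactor ψ) (2 * k) x y) /
        ((halfOpenBox 2 (2 * k)).card : ℝ) ^ 2) atTop :=
    hS (fun L => 2 * ⌊(1 - δ) * (L : ℝ) ^ 2 / 2⌋₊) ψ fun L _ => ⟨rfl, hψu L, hψgs L⟩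
  have hfreq : ∀ ε : ℝ, 0 < ε → ∃ᶠ k in atTop, (∑ x ∈ halfOpenBox 2 (2 * k), ∑ y ∈ halfOpenBox 2 (2 * k),
          torusPullback (pairFieldCorr dWaveFormFactor ψ) (2 * k) x y) /
        ((halfOpenBox 2 (2 * k)).card : ℝ) ^ 2 ≤ ε := by
    intro ε hε
    obtain ⟨n, hn⟩ := exists_nat_one_div_lt hε
    refine frequently_atTop.2 fun K₀ => ?_
    obtain ⟨L, hL, hE, hbad⟩ := key n (2 * K₀ + n + 2)
    obtain ⟨k, hk⟩ : ∃ k, L = 2 * k := ⟨L / 2, (Nat.two_mul_div_two_of_even hE).symm⟩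
    subst hk
    refine ⟨k, by omega, ?_⟩
    haveI : NeZero (2 * k) := ⟨by omega⟩
    have hb' : bad (lvl (2 * k)) (2 * k) := hspec _ n (by omega) hbad
    have hnl : n ≤ lvl (2 * k) := hge _ n (by omega) hbad
    obtain ⟨_, hlt⟩ := hψbad (2 * k) hb'
    have hX : (0 : ℝ) ≤ ((2 * k : ℕ) : ℝ) ^ 4 := by positivity
    have h1 : 1 / ((lvl (2 * k) : ℝ) + 1) ≤ 1 / ((n : ℝ) + 1) :=
      one_div_le_one_div_of_le (by positivity) (by exact_mod_cast Nat.succ_le_succ hnl)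
    rw [lroTerm_eq, div_le_iff₀ (side_pow_pos k)]
    calc (expect ((pairField dWaveFormFactor (2 * k))ᴴ * pairField dWaveFormFactor (2 * k)) (ψ (2 * k))).re
        ≤ 1 / ((lvl (2 * k) : ℝ) + 1) * ((2 * k : ℕ) : ℝ) ^ 4 := le_of_lt hlt
      _ ≤ 1 / ((n : ℝ) + 1) * ((2 * k : ℕ) : ℝ) ^ 4 := mul_le_mul_of_nonneg_right h1 hX
      _ ≤ ε * ((2 * k : ℕ) : ℝ) ^ 4 := mul_le_mul_of_nonneg_right hn.le hX
  have hle : liminf (fun k : ℕ => (∑ x ∈ halfOpenBox 2 (2 * k), ∑ y ∈ halfOpenBox 2 (2 * k),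
          torusPullback (pairFieldCorr dWaveFormFactor ψ) (2 * k) x y) /
        ((halfOpenBox 2 (2 * k)).card : ℝ) ^ 2) atTop ≤
      liminf (fun k : ℕ => (∑ x ∈ halfOpenBox 2 (2 * k), ∑ y ∈ halfOpenBox 2 (2 * k),
          torusPullback (pairFieldCorr dWaveFormFactor ψ) (2 * k) x y) /
        ((halfOpenBox 2 (2 * k)).card : ℝ) ^ 2) atTop / 2 :=
    liminf_le_of_frequently_le (hfreq _ (half_pos hLRO))
      (isBoundedUnder_of ⟨0, fun k => lroTerm_nonneg ψ k⟩)
  linarith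

/-- **The summit's matrix at `(U,δ)` is the every-GS order bound of the pure torus** (`δ ≥ −1`). [folklore] -/
theorem summitMatrix_iff_everyGSOrder {U δ : ℝ} (hδ : -1 ≤ δ) :
    (∀ (N : ℕ → ℕ) (ψ : ∀ L, Fock (Orb (FermionTorus 2 L))),
        (∀ L, Even L → N L = 2 * ⌊(1 - δ) * (L : ℝ) ^ 2 / 2⌋₊ ∧ star (ψ L) ⬝ᵥ ψ L = 1 ∧
            IsGroundStateInSector (hubbardTorus 2 L 1 U) (N L) 0 (ψ L)) →
          HasLongRangeOrder (fun k => halfOpenBox 2 (2 * k))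
            (fun k => torusPullback (pairFieldCorr dWaveFormFactor ψ) (2 * k))) ↔
    (∃ c : ℝ, 0 < c ∧ ∃ L₀ : ℕ, ∀ (L : ℕ) [NeZero L], L₀ ≤ L → Even L →
        ∀ ψ : Fock (Orb (FermionTorus 2 L)), star ψ ⬝ᵥ ψ = 1 →
          IsGroundStateInSector (hubbardTorus 2 L 1 U) (2 * ⌊(1 - δ) * (L : ℝ) ^ 2 / 2⌋₊) 0 ψ →
            c * (L : ℝ) ^ 4 ≤ (expect ((pairField dWaveFormFactor L)ᴴ * pairField dWaveFormFactor L) ψ).re) :=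
  ⟨everyGSOrder_of_summitMatrix hδ, summitMatrix_of_everyGSOrder⟩

/-- Seed `0` of the seeded family is the pure torus (order-bound version). [folklore] -/
theorem everyGSOrder_zero_iff {U δ : ℝ} :
    (∃ c : ℝ, 0 < c ∧ ∃ L₀ : ℕ, ∀ (L : ℕ) [NeZero L], L₀ ≤ L → Even L →
        ∀ ψ : Fock (Orb (FermionTorus 2 L)), star ψ ⬝ᵥ ψ = 1 →
          IsGroundStateInSector (hubbardTorus 2 L 1 U - ((0 / (L : ℝ) ^ 2 : ℝ) : ℂ) • ((pairField dWaveFormFactor L)ᴴ * pairField dWaveFormFactor L)) (2 * ⌊(1 - δ) * (L : ℝ) ^ 2 / 2⌋₊) 0 ψ →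
            c * (L : ℝ) ^ 4 ≤ (expect ((pairField dWaveFormFactor L)ᴴ * pairField dWaveFormFactor L) ψ).re) ↔
    (∃ c : ℝ, 0 < c ∧ ∃ L₀ : ℕ, ∀ (L : ℕ) [NeZero L], L₀ ≤ L → Even L →
        ∀ ψ : Fock (Orb (FermionTorus 2 L)), star ψ ⬝ᵥ ψ = 1 →
          IsGroundStateInSector (hubbardTorus 2 L 1 U) (2 * ⌊(1 - δ) * (L : ℝ) ^ 2 / 2⌋₊) 0 ψ →
            c * (L : ℝ) ^ 4 ≤ (expect ((pairField dWaveFormFactor L)ᴴ * pairField dWaveFormFactor L) ψ).re) := by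
  simp only [seededH_zero]

/-! ### The crux in normal form -/

/-- **`TwTipContinuation` in normal form**: the slope `K` collapses to `1/(20U)` (it is quantified after
`U` under `K·U ≤ 1/20`), the seed band to its lower edge `1/20` (monotonicity), and the conclusion is
the every-GS order bound of the pure torus: the crux says that at one `δ` of the window, for all small
`U`, "lit at seed `1/20` ⇒ lit at seed `0`" — the threshold seed is not in `(0, 1/20]`. [folklore] -/
theorem twTipContinuation_iff_threshold :
    TwTipContinuation ↔
      ∃ U₁ : ℝ, 0 < U₁ ∧ ∃ δ ∈ Set.Icc (1 / 10 : ℝ) (2 / 5), ∀ U ∈ Set.Ioc (0 : ℝ) U₁,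
        (∃ c : ℝ, 0 < c ∧ ∃ L₀ : ℕ, ∀ (L : ℕ) [NeZero L], L₀ ≤ L → Even L →
        ∀ ψ : Fock (Orb (FermionTorus 2 L)), star ψ ⬝ᵥ ψ = 1 →
          IsGroundStateInSector (hubbardTorus 2 L 1 U - (((1 / 20 : ℝ) / (L : ℝ) ^ 2 : ℝ) : ℂ) • ((pairField dWaveFormFactor L)ᴴ * pairField dWaveFormFactor L)) (2 * ⌊(1 - δ) * (L : ℝ) ^ 2 / 2⌋₊) 0 ψ →
            c * (L : ℝ) ^ 4 ≤ (expect ((pairField dWaveFormFactor L)ᴴ * pairField dWaveFormFactor L) ψ).re) →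
        (∃ c : ℝ, 0 < c ∧ ∃ L₀ : ℕ, ∀ (L : ℕ) [NeZero L], L₀ ≤ L → Even L →
        ∀ ψ : Fock (Orb (FermionTorus 2 L)), star ψ ⬝ᵥ ψ = 1 →
          IsGroundStateInSector (hubbardTorus 2 L 1 U) (2 * ⌊(1 - δ) * (L : ℝ) ^ 2 / 2⌋₊) 0 ψ →
            c * (L : ℝ) ^ 4 ≤ (expect ((pairField dWaveFormFactor L)ᴴ * pairField dWaveFormFactor L) ψ).re) := by
  unfold TwTipContinuation
  refine exists_congr fun U₁ => and_congr_right fun _ => exists_congr fun δ =>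
    and_congr_right fun hδ => forall₂_congr fun U hU => ?_
  have hδ' : (-1 : ℝ) ≤ δ := by linarith [hδ.1]
  rw [summitMatrix_iff_everyGSOrder hδ']
  constructor
  · intro h hOB
    have hUpos : 0 < U := hU.1
    have hK : 0 < 1 / (20 * U) := by positivity
    have hKU : 1 / (20 * U) * U = 1 / 20 := by field_simp
    refine h _ hK hKU.le fun g hg => ?_
    rw [hKU] at hg
    exact everyGSOrder_mono hg.1 hOB
  · intro h K _ hKU hR
    exact h (everyGSOrder_mono hKU (hR (K * U) ⟨le_rfl, by linarith⟩))

/-- **What a refutation needs**: at EVERY `δ ∈ [1/10,2/5]` and for arbitrarily small `U > 0`, every-GS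
d-wave order of the O(1)-seeded (`g = 1/20`) repulsive torus AND a ground-state branch of the pure
torus without it. Both conjuncts are open (2026-08). [folklore] -/
theorem not_twTipContinuation_iff :
    ¬ TwTipContinuation ↔
      ∀ U₁ : ℝ, 0 < U₁ → ∀ δ ∈ Set.Icc (1 / 10 : ℝ) (2 / 5), ∃ U ∈ Set.Ioc (0 : ℝ) U₁,
        (∃ c : ℝ, 0 < c ∧ ∃ L₀ : ℕ, ∀ (L : ℕ) [NeZero L], L₀ ≤ L → Even L →
        ∀ ψ : Fock (Orb (FermionTorus 2 L)), star ψ ⬝ᵥ ψ = 1 →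
          IsGroundStateInSector (hubbardTorus 2 L 1 U - (((1 / 20 : ℝ) / (L : ℝ) ^ 2 : ℝ) : ℂ) • ((pairField dWaveFormFactor L)ᴴ * pairField dWaveFormFactor L)) (2 * ⌊(1 - δ) * (L : ℝ) ^ 2 / 2⌋₊) 0 ψ →
            c * (L : ℝ) ^ 4 ≤ (expect ((pairField dWaveFormFactor L)ᴴ * pairField dWaveFormFactor L) ψ).re) ∧
        ¬ (∃ c : ℝ, 0 < c ∧ ∃ L₀ : ℕ, ∀ (L : ℕ) [NeZero L], L₀ ≤ L → Even L →
        ∀ ψ : Fock (Orb (FermionTorus 2 L)), star ψ ⬝ᵥ ψ = 1 →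
          IsGroundStateInSector (hubbardTorus 2 L 1 U) (2 * ⌊(1 - δ) * (L : ℝ) ^ 2 / 2⌋₊) 0 ψ →
            c * (L : ℝ) ^ 4 ≤ (expect ((pairField dWaveFormFactor L)ᴴ * pairField dWaveFormFactor L) ψ).re) := by
  rw [twTipContinuation_iff_threshold]
  simp only [not_exists, not_and, Classical.not_imp, not_forall]

/-- **Vacuity hazard**: FAILURE of the O(1)-seeded anchor (seed `1/20`) at one `δ` of the window for all
small `U` PROVES the crux (while making the thesis `TwSeededRung ∧ TwTipContinuation` false). [folklore] -/
theorem twTipContinuation_of_anchorFailure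
    (h : ∃ U₁ : ℝ, 0 < U₁ ∧ ∃ δ ∈ Set.Icc (1 / 10 : ℝ) (2 / 5), ∀ U ∈ Set.Ioc (0 : ℝ) U₁,
      ¬ (∃ c : ℝ, 0 < c ∧ ∃ L₀ : ℕ, ∀ (L : ℕ) [NeZero L], L₀ ≤ L → Even L →
        ∀ ψ : Fock (Orb (FermionTorus 2 L)), star ψ ⬝ᵥ ψ = 1 →
          IsGroundStateInSector (hubbardTorus 2 L 1 U - (((1 / 20 : ℝ) / (L : ℝ) ^ 2 : ℝ) : ℂ) • ((pairField dWaveFormFactor L)ᴴ * pairField dWaveFormFactor L)) (2 * ⌊(1 - δ) * (L : ℝ) ^ 2 / 2⌋₊) 0 ψ →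
            c * (L : ℝ) ^ 4 ≤ (expect ((pairField dWaveFormFactor L)ᴴ * pairField dWaveFormFactor L) ψ).re)) :
    TwTipContinuation := by
  obtain ⟨U₁, hU₁, δ, hδ, h⟩ := h
  exact twTipContinuation_iff_threshold.2 ⟨U₁, hU₁, δ, hδ, fun U hU hR => absurd hR (h U hU)⟩

/-- The intended reading: the `U`-uniform summit conclusion at one `δ` of the window (weak-coupling
d-wave superconductivity) proves the crux. [folklore] -/
theorem twTipContinuation_of_uniformSummit
    (h : ∃ U₁ : ℝ, 0 < U₁ ∧ ∃ δ ∈ Set.Icc (1 / 10 : ℝ) (2 / 5), ∀ U ∈ Set.Ioc (0 : ℝ) U₁,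
      (∀ (N : ℕ → ℕ) (ψ : ∀ L, Fock (Orb (FermionTorus 2 L))),
        (∀ L, Even L → N L = 2 * ⌊(1 - δ) * (L : ℝ) ^ 2 / 2⌋₊ ∧ star (ψ L) ⬝ᵥ ψ L = 1 ∧
            IsGroundStateInSector (hubbardTorus 2 L 1 U) (N L) 0 (ψ L)) →
          HasLongRangeOrder (fun k => halfOpenBox 2 (2 * k))
            (fun k => torusPullback (pairFieldCorr dWaveFormFactor ψ) (2 * k)))) :
    TwTipContinuation := by
  obtain ⟨U₁, hU₁, δ, hδ, h⟩ := h
  exact ⟨U₁, hU₁, δ, hδ, fun U hU _ _ _ _ => h U hU⟩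

/-- Negative-side tool: DARK AT ANY SEED `g ≥ 0` (no uniform every-GS order of the seeded torus)
refutes the summit's conclusion at `(U,δ)` — every rung of the anchor is NECESSARY there. [folklore] -/
theorem not_summitMatrix_of_darkSeed {U δ g : ℝ} (hδ : -1 ≤ δ) (hg : 0 ≤ g)
    (h : ¬ (∃ c : ℝ, 0 < c ∧ ∃ L₀ : ℕ, ∀ (L : ℕ) [NeZero L], L₀ ≤ L → Even L →
        ∀ ψ : Fock (Orb (FermionTorus 2 L)), star ψ ⬝ᵥ ψ = 1 →
          IsGroundStateInSector (hubbardTorus 2 L 1 U - ((g / (L : ℝ) ^ 2 : ℝ) : ℂ) • ((pairField dWaveFormFactor L)ᴴ * pairField dWaveFormFactor L)) (2 * ⌊(1 - δ) * (L : ℝ) ^ 2 / 2⌋₊) 0 ψ →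
            c * (L : ℝ) ^ 4 ≤ (expect ((pairField dWaveFormFactor L)ᴴ * pairField dWaveFormFactor L) ψ).re)) :
    ¬ (∀ (N : ℕ → ℕ) (ψ : ∀ L, Fock (Orb (FermionTorus 2 L))),
        (∀ L, Even L → N L = 2 * ⌊(1 - δ) * (L : ℝ) ^ 2 / 2⌋₊ ∧ star (ψ L) ⬝ᵥ ψ L = 1 ∧
            IsGroundStateInSector (hubbardTorus 2 L 1 U) (N L) 0 (ψ L)) →
          HasLongRangeOrder (fun k => halfOpenBox 2 (2 * k))
            (fun k => torusPullback (pairFieldCorr dWaveFormFactor ψ) (2 * k))) :=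
  fun hS => h (everyGSOrder_mono hg
    ((everyGSOrder_zero_iff (δ := δ)).2 (everyGSOrder_of_summitMatrix hδ hS)))

end Summit.HubbardSuperconductivity.TwTipContinuation.Negative
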